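import Summits.QuantumFields.BalabanUV.Beta.FP.ExpLocalisedBubble

/-!
# `BalabanUV.Beta.FP.ExpLocalisedBubblePoint` — road «FP», N7 H-route, row H2-a (exp-localised vertices): THE POWER COUNTING AT A POINT OF `ℤ⁴` —
# `Σ_{x,y} c(x,y)·F(z+x−y) = (Σ c)·F(z) + Σ_i m_i(c)·Δ_iF(z) + O((‖z‖∞+1)^{−a−2})` and `= (Σ c)·F(z) + O((‖z‖∞+1)^{−a−1})` for an exponentially localised
# two-point weight `c` and a kernel `F` with `|F| ≲ ‖·‖^{−a}`, `|ΔF| ≲ ‖·‖^{−a−1}`, `|ΔΔF| ≲ ‖·‖^{−a−2}`, constants DISPLAYED ([folklore]; nothing of the manuscripts)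

HONEST DEPENDENCY (page 1, mandatory): continuum YM on T⁴ ⇐ BetaPertH ∧ nine spine estimates (0/9 proved); BetaPertH ⇐ (D1) ∧ (D4) ∧
CAP+tail; G-an2-4 gates asym, D1 and NE2/3/4.  HONEST FRAMING (cell contract, verbatim): «discharging `BetaPertH` makes Bałaban's UV
stability UNCONDITIONAL — a real constructive-QFT result; it is NOT the continuum limit and NOT the Clay problem.»  THIS MODULE specialises BY NAME the engine
`FP/ExpLocalisedBubble` (`abs_smear_sub_order0_le` ∕ `abs_smear_sub_order1_le`) at a point `z ∈ ℤ⁴` with the near radius `ρ := ⌊‖z‖∞/4⌋` (`‖z‖∞ ≥ 4`; the core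
`‖z‖∞ ≤ 3` by the global bounds), the far exponent `k := a+1` ∕ `a+2`, and the `ℤ⁴` geometry of `FP/HorizontalBookkeepingTail` (`supNorm_le_add_of_box`; `quarter_bounds` is the
`N = 1` case of `…TailPointwise.rho_bounds`).  Every analytic input is a HYPOTHESIS displayed in the signatures; no `def`, no `Prop` fact, 0 sorry.  NOT the bubble of the perfect theory
(rows H2-P-*, H2-b-ALG supply `F` = leg germs and `c` = vertex stencils), NOT `hgerm`, NOT `hasym`, NOT D1, NOT BetaPertH, NOT continuum, NOT Clay.

CONTENT (`Θ_m := 2^{m+1}·(m!e^{δ/2}(2/δ)^m)·e^{δ/2}·Zl 4 (δ/2)²` — the two-point letters of the engine; `n := ‖z‖∞`).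
* `box_geometry_one` — for `‖z‖∞ ≥ 4` and `|t_i − z_i| ≤ ⌊‖z‖∞/4⌋`: `(3/4)‖z‖∞ ≤ ‖t‖∞ + 1`.
* **`abs_smear_sub_order1_le_point`** — `|Σ' c·F(z+x−y) − (Σ'c)·F z − Σ_i m_i·Δ_iF z| ≤ K₁/(‖z‖∞+1)^{a+2}` for EVERY `z`, with
  `K₁ := C·((5/4)^{a+2}·(20·A₂·Θ₂/(3/4)^{a+2} + (2A₀·Θ_{a+2} + A₁·Θ_{a+3})·16^{a+2}) + 4^{a+2}·(2A₀·Θ₀ + 4A₁·Θ₁))`.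
* **`abs_smear_sub_order0_le_point`** — `|Σ' c·F(z+x−y) − (Σ'c)·F z| ≤ K₀/(‖z‖∞+1)^{a+1}`,
  `K₀ := C·((5/4)^{a+1}·(4·A₁·(4/3)^{a+1}·Θ₁ + 2A₀·Θ_{a+1}·16^{a+1}) + 4^{a+1}·2A₀·Θ₀)`.
Unit `b2b-balaban-beta-d1-formalise-leaf-02` (gen 6).
-/

noncomputable section

namespace Summit.QuantumFields.BalabanUV.Beta.FP.ExpLocalisedBubblePoint

open Finset Filter Topology fwdDiff
open scoped BigOperators
open Literature.MathematicalPhysics.QuantumFieldTheory.Balaban1983to89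
open Literature.MathematicalPhysics.QuantumFieldTheory.Balaban1983to89.Beta
open B12Sec2to5 (l1 l1_nonneg abs_coord_le_l1)
open ExpKernelCalculus (Site Zl Zl_pos)
open Summit.QuantumFields.BalabanUV.Beta.FP.HorizontalBookkeepingTail (supNorm_le_add_of_box)
open Summit.QuantumFields.BalabanUV.Beta.FP.ExpLocalisedBubble
open DyadicShell (Pt supNorm supNorm_eq_zero_iff)

/-- [folklore] `⌊n/4⌋ ≥ 1`, `4⌊n/4⌋ ≤ n ≤ 16⌊n/4⌋` for `n ≥ 4`. -/
theorem quarter_bounds {n : ℕ} (hn : 4 ≤ n) : 1 ≤ n / 4 ∧ 4 * (n / 4) ≤ n ∧ n ≤ 16 * (n / 4) := by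
  refine ⟨(Nat.le_div_iff_mul_le (by norm_num)).mpr (by omega), Nat.mul_div_le n 4, by omega⟩

/-- [folklore] GEOMETRY OF THE NEAR BOX (no blocking): `‖z‖∞ ≥ 4`, `|t_i − z_i| ≤ ⌊‖z‖∞/4⌋` for all `i` ⟹ `(3/4)·‖z‖∞ ≤ ‖t‖∞ + 1`. -/
theorem box_geometry_one {z t : Pt} (hz : 4 ≤ supNorm z) (ht : ∀ i, |t i - z i| ≤ ((supNorm z / 4 : ℕ) : ℤ)) :
    (3 / 4 : ℝ) * (supNorm z : ℝ) ≤ (supNorm t : ℝ) + 1 := by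
  obtain ⟨_, h4, _⟩ := quarter_bounds hz
  have hbox := supNorm_le_add_of_box ht
  have h : 3 * supNorm z ≤ 4 * supNorm t := by omega
  have h' : (3 : ℝ) * (supNorm z : ℝ) ≤ 4 * (supNorm t : ℝ) := by exact_mod_cast h
  linarith

section Point

variable {c : Pt × Pt → ℝ} {F : Pt → ℝ} {C δ A₀ A₁ A₂ : ℝ} {a : ℕ}

/-- [folklore] The decay constants are nonnegative (read at the origin). -/
theorem nonneg_of_decay_pow {G : Pt → ℝ} {A : ℝ} {b : ℕ} (h : ∀ t : Pt, |G t| ≤ A / ((supNorm t : ℝ) + 1) ^ b) : 0 ≤ A := by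
  have h0 := h 0
  rw [supNorm_eq_zero_iff.mpr rfl, Nat.cast_zero, zero_add, one_pow, div_one] at h0
  exact (abs_nonneg _).trans h0

/-- **H2-a, ORDER ONE, AT A POINT**: `|c(x,y)| ≤ C·e^{−δ(|x|₁+|y|₁)}`, `|F t| ≤ A₀/(‖t‖∞+1)^a`, `|Δ_iF t| ≤ A₁/(‖t‖∞+1)^{a+1}`, `|Δ_iΔ_jF t| ≤ A₂/(‖t‖∞+1)^{a+2}` ⟹
for EVERY `z ∈ ℤ⁴`, with `m_i := Σ'_{x,y} c(x,y)·(x−y)_i`,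
`|Σ'_{x,y} c(x,y)·F(z+x−y) − (Σ' c)·F z − Σ_i m_i·Δ_iF z| ≤ K₁/(‖z‖∞+1)^{a+2}` with the displayed `K₁(C,δ,A₀,A₁,A₂,a)`. [folklore] -/
theorem abs_smear_sub_order1_le_point (hδ : 0 < δ)
    (hc : ∀ p : Pt × Pt, |c p| ≤ C * (Real.exp (-δ * l1 p.1) * Real.exp (-δ * l1 p.2)))
    (hF0 : ∀ t : Pt, |F t| ≤ A₀ / ((supNorm t : ℝ) + 1) ^ a)
    (hF1 : ∀ (t : Pt) (i : Fin 4), |Δ_[(Pi.single i 1 : Pt)] F t| ≤ A₁ / ((supNorm t : ℝ) + 1) ^ (a + 1))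
    (hF2 : ∀ (t : Pt) (i j : Fin 4), |Δ_[(Pi.single i 1 : Pt)] (Δ_[(Pi.single j 1 : Pt)] F) t| ≤ A₂ / ((supNorm t : ℝ) + 1) ^ (a + 2))
    (z : Pt) :
    |∑' p : Pt × Pt, c p * F (z + p.1 - p.2) - (∑' p : Pt × Pt, c p) * F z
        - ∑ i, (∑' p : Pt × Pt, c p * ((p.1 - p.2) i : ℝ)) * Δ_[(Pi.single i 1 : Pt)] F z|
      ≤ C * ((5 / 4 : ℝ) ^ (a + 2)
              * (20 * A₂ * (2 ^ (2 + 1) * (((2 : ℕ).factorial : ℝ) * Real.exp (δ / 2) * (2 / δ) ^ 2) * Real.exp (δ / 2) * Zl 4 (δ / 2) ^ 2) / (3 / 4 : ℝ) ^ (a + 2)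
                + (2 * A₀ * (2 ^ (a + 2 + 1) * (((a + 2).factorial : ℝ) * Real.exp (δ / 2) * (2 / δ) ^ (a + 2)) * Real.exp (δ / 2) * Zl 4 (δ / 2) ^ 2)
                    + A₁ * (2 ^ (a + 2 + 1 + 1) * (((a + 2 + 1).factorial : ℝ) * Real.exp (δ / 2) * (2 / δ) ^ (a + 2 + 1)) * Real.exp (δ / 2) * Zl 4 (δ / 2) ^ 2))
                  * 16 ^ (a + 2))
            + (4 : ℝ) ^ (a + 2) * (2 * A₀ * (2 ^ (0 + 1) * (((0 : ℕ).factorial : ℝ) * Real.exp (δ / 2) * (2 / δ) ^ 0) * Real.exp (δ / 2) * Zl 4 (δ / 2) ^ 2)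
                + 4 * A₁ * (2 ^ (1 + 1) * (((1 : ℕ).factorial : ℝ) * Real.exp (δ / 2) * (2 / δ) ^ 1) * Real.exp (δ / 2) * Zl 4 (δ / 2) ^ 2)))
          / ((supNorm z : ℝ) + 1) ^ (a + 2) := by
  have hC := nonneg_of_loc hc
  have hA0 := nonneg_of_decay_pow hF0
  have hA1 : 0 ≤ A₁ := nonneg_of_decay_pow (fun t => hF1 t 0)
  have hA2 : 0 ≤ A₂ := nonneg_of_decay_pow (fun t => hF2 t 0 0)
  -- the letters, abbreviated
  set Θ0 : ℝ := 2 ^ (0 + 1) * (((0 : ℕ).factorial : ℝ) * Real.exp (δ / 2) * (2 / δ) ^ 0) * Real.exp (δ / 2) * Zl 4 (δ / 2) ^ 2 with hΘ0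
  set Θ1 : ℝ := 2 ^ (1 + 1) * (((1 : ℕ).factorial : ℝ) * Real.exp (δ / 2) * (2 / δ) ^ 1) * Real.exp (δ / 2) * Zl 4 (δ / 2) ^ 2 with hΘ1
  set Θ2 : ℝ := 2 ^ (2 + 1) * (((2 : ℕ).factorial : ℝ) * Real.exp (δ / 2) * (2 / δ) ^ 2) * Real.exp (δ / 2) * Zl 4 (δ / 2) ^ 2 with hΘ2
  set Θk : ℝ := 2 ^ (a + 2 + 1) * (((a + 2).factorial : ℝ) * Real.exp (δ / 2) * (2 / δ) ^ (a + 2)) * Real.exp (δ / 2) * Zl 4 (δ / 2) ^ 2 with hΘk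
  set Θk1 : ℝ := 2 ^ (a + 2 + 1 + 1) * (((a + 2 + 1).factorial : ℝ) * Real.exp (δ / 2) * (2 / δ) ^ (a + 2 + 1)) * Real.exp (δ / 2) * Zl 4 (δ / 2) ^ 2
    with hΘk1
  have hZ : 0 < Zl 4 (δ / 2) := Zl_pos (half_pos hδ)
  have hΘ0p : 0 ≤ Θ0 := by positivity
  have hΘ1p : 0 ≤ Θ1 := by positivity
  have hΘ2p : 0 ≤ Θ2 := by positivity
  have hΘkp : 0 ≤ Θk := by positivity
  have hΘk1p : 0 ≤ Θk1 := by positivity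
  set Kout : ℝ := 20 * A₂ * Θ2 / (3 / 4 : ℝ) ^ (a + 2) + (2 * A₀ * Θk + A₁ * Θk1) * 16 ^ (a + 2) with hKout
  set Kcore : ℝ := 2 * A₀ * Θ0 + 4 * A₁ * Θ1 with hKcore
  have hKout0 : 0 ≤ Kout := by positivity
  have hKcore0 : 0 ≤ Kcore := by positivity
  set n : ℝ := (supNorm z : ℝ) with hn
  have hn0 : 0 ≤ n := by positivity
  -- global bounds
  have hFA : ∀ t, |F t| ≤ A₀ := fun t => (hF0 t).trans (div_le_self hA0 (one_le_pow₀ (by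
    have := (Nat.cast_nonneg (supNorm t) : (0:ℝ) ≤ _); linarith)))
  have hF1z : ∀ i, |Δ_[(Pi.single i 1 : Pt)] F z| ≤ A₁ := fun i => (hF1 z i).trans (div_le_self hA1 (one_le_pow₀ (by linarith)))
  show _ ≤ C * ((5 / 4 : ℝ) ^ (a + 2) * Kout + (4 : ℝ) ^ (a + 2) * Kcore) / (n + 1) ^ (a + 2)
  by_cases hz : 4 ≤ supNorm z
  · -- OUTER: near box of radius ρ = ⌊n/4⌋, far exponent a+2
    obtain ⟨hρ1, hρ4, hρ16⟩ := quarter_bounds hz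
    set ρ : ℕ := supNorm z / 4 with hρ
    have hn4 : (4 : ℝ) ≤ n := by rw [hn]; exact_mod_cast hz
    have hρpos : (0 : ℝ) < ρ := by exact_mod_cast hρ1
    have h16 : n ≤ 16 * (ρ : ℝ) := by rw [hn]; exact_mod_cast hρ16
    set B : ℝ := A₂ / ((3 / 4 : ℝ) * n) ^ (a + 2) with hB
    have hB0 : 0 ≤ B := by positivity
    have hF2box : ∀ t : Pt, (∀ i, |t i - z i| ≤ (ρ : ℤ)) →
        ∀ i j, |Δ_[(Pi.single i 1 : Pt)] (Δ_[(Pi.single j 1 : Pt)] F) t| ≤ B := by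
      intro t ht i j
      have hgeo := box_geometry_one hz ht
      refine (hF2 t i j).trans ?_
      have key : ((3 / 4 : ℝ) * n) ^ (a + 2) ≤ ((supNorm t : ℝ) + 1) ^ (a + 2) := pow_le_pow_left₀ (by positivity) hgeo _
      exact div_le_div_of_nonneg_left hA2 (by positivity) key
    have hmain := abs_smear_sub_order1_le (D := 4) hδ hc hFA hρ1 hB0 hA1 (a + 2) hF1z hF2box
    refine hmain.trans ?_
    -- `D(D+1) = 20`; `B·Θ₂`-term and the `ρ^{-(a+2)}`-terms against `n^{-(a+2)}`
    have hρinv : 1 / (ρ : ℝ) ^ (a + 2) ≤ (16 : ℝ) ^ (a + 2) / n ^ (a + 2) := by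
      rw [div_le_div_iff₀ (by positivity) (by positivity), one_mul, ← mul_pow]
      exact pow_le_pow_left₀ hn0 h16 _
    have hn_ne : n ≠ 0 := by linarith
    have h34 : ((3 : ℝ) / 4) ^ (a + 2) ≠ 0 := by positivity
    have step1 : C * (((4 : ℕ) : ℝ) * (((4 : ℕ) : ℝ) + 1) * B * Θ2 + (2 * A₀ * Θk + A₁ * Θk1) / (ρ : ℝ) ^ (a + 2))
        ≤ C * (Kout / n ^ (a + 2)) := by
      refine mul_le_mul_of_nonneg_left ?_ hC
      have t1 : ((4 : ℕ) : ℝ) * (((4 : ℕ) : ℝ) + 1) * B * Θ2 = (20 * A₂ * Θ2 / (3 / 4 : ℝ) ^ (a + 2)) / n ^ (a + 2) := by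
        rw [hB, mul_pow]; push_cast; field_simp; ring
      have t2 : (2 * A₀ * Θk + A₁ * Θk1) / (ρ : ℝ) ^ (a + 2) ≤ (2 * A₀ * Θk + A₁ * Θk1) * 16 ^ (a + 2) / n ^ (a + 2) := by
        have hnum : 0 ≤ 2 * A₀ * Θk + A₁ * Θk1 := by positivity
        calc (2 * A₀ * Θk + A₁ * Θk1) / (ρ : ℝ) ^ (a + 2) = (2 * A₀ * Θk + A₁ * Θk1) * (1 / (ρ : ℝ) ^ (a + 2)) := by ring
          _ ≤ (2 * A₀ * Θk + A₁ * Θk1) * ((16 : ℝ) ^ (a + 2) / n ^ (a + 2)) := mul_le_mul_of_nonneg_left hρinv hnum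
          _ = _ := by ring
      have eK : Kout / n ^ (a + 2) = (20 * A₂ * Θ2 / (3 / 4 : ℝ) ^ (a + 2)) / n ^ (a + 2) + (2 * A₀ * Θk + A₁ * Θk1) * 16 ^ (a + 2) / n ^ (a + 2) := by
        rw [hKout, add_div]
      rw [t1, eK]
      linarith
    refine step1.trans ?_
    -- `Kout/n^{a+2} ≤ ((5/4)^{a+2} Kout + 4^{a+2} Kcore)/(n+1)^{a+2}`
    have h54 : Kout / n ^ (a + 2) ≤ (5 / 4 : ℝ) ^ (a + 2) * Kout / (n + 1) ^ (a + 2) := by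
      rw [div_le_div_iff₀ (by positivity) (by positivity)]
      have key : (n + 1) ^ (a + 2) ≤ ((5 / 4 : ℝ) * n) ^ (a + 2) := pow_le_pow_left₀ (by positivity) (by linarith) _
      calc Kout * (n + 1) ^ (a + 2) ≤ Kout * ((5 / 4 : ℝ) * n) ^ (a + 2) := mul_le_mul_of_nonneg_left key hKout0
        _ = (5 / 4 : ℝ) ^ (a + 2) * Kout * n ^ (a + 2) := by rw [mul_pow]; ring
    have h55 : (5 / 4 : ℝ) ^ (a + 2) * Kout / (n + 1) ^ (a + 2) ≤ ((5 / 4 : ℝ) ^ (a + 2) * Kout + (4 : ℝ) ^ (a + 2) * Kcore) / (n + 1) ^ (a + 2) :=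
      div_le_div_of_nonneg_right (le_add_of_nonneg_right (by positivity)) (by positivity)
    calc C * (Kout / n ^ (a + 2)) ≤ C * ((5 / 4 : ℝ) ^ (a + 2) * Kout / (n + 1) ^ (a + 2)) := mul_le_mul_of_nonneg_left h54 hC
      _ ≤ C * (((5 / 4 : ℝ) ^ (a + 2) * Kout + (4 : ℝ) ^ (a + 2) * Kcore) / (n + 1) ^ (a + 2)) := mul_le_mul_of_nonneg_left h55 hC
      _ = _ := by ring
  · -- CORE: crude bounds
    have hz3 : supNorm z ≤ 3 := by omega
    have hn3 : n ≤ 3 := by simp only [hn]; exact_mod_cast hz3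
    have hsm := summable_smear hδ hc hFA z
    have hw := summable_weight hδ hc
    have h0 := summable_loc_mul_pow hδ hc 0
    simp only [pow_zero, mul_one] at h0
    have h0b : ∑' p : Pt × Pt, |c p| ≤ C * Θ0 := by
      have h := tsum_loc_mul_pow_le hδ hc 0
      rw [hΘ0]
      calc ∑' p : Pt × Pt, |c p| = ∑' p : Pt × Pt, |c p| * ((l1 p.1 + 1) + (l1 p.2 + 1)) ^ 0 := by simp
        _ ≤ _ := h
    have h1b : ∑' p : Pt × Pt, |c p| * ((l1 p.1 + 1) + (l1 p.2 + 1)) ^ 1 ≤ C * Θ1 := by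
      rw [hΘ1]; exact tsum_loc_mul_pow_le hδ hc 1
    -- |Σ' c F(z+·)| ≤ A₀ Σ'|c| ≤ A₀ C Θ0
    have e1 : |∑' p : Pt × Pt, c p * F (z + p.1 - p.2)| ≤ C * Θ0 * A₀ := by
      have h := tsum_of_norm_bounded (h0.mul_right A₀).hasSum (f := fun p : Pt × Pt => c p * F (z + p.1 - p.2)) (fun p => by
        rw [Real.norm_eq_abs, abs_mul]; exact mul_le_mul_of_nonneg_left (hFA _) (abs_nonneg _))
      rw [Real.norm_eq_abs, tsum_mul_right] at h
      exact h.trans (mul_le_mul_of_nonneg_right h0b hA0)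
    have e2 : |(∑' p : Pt × Pt, c p) * F z| ≤ C * Θ0 * A₀ := by
      rw [abs_mul]
      have h := norm_tsum_le_tsum_norm hw.norm
      simp only [Real.norm_eq_abs] at h
      exact mul_le_mul (h.trans h0b) (hFA z) (abs_nonneg _) (by positivity)
    have e3 : |∑ i, (∑' p : Pt × Pt, c p * ((p.1 - p.2) i : ℝ)) * Δ_[(Pi.single i 1 : Pt)] F z| ≤ 4 * (C * Θ1 * A₁) := by
      refine (Finset.abs_sum_le_sum_abs _ _).trans ?_
      have hi : ∀ i ∈ (Finset.univ : Finset (Fin 4)), |(∑' p : Pt × Pt, c p * ((p.1 - p.2) i : ℝ)) * Δ_[(Pi.single i 1 : Pt)] F z| ≤ C * Θ1 * A₁ := by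
        intro i _
        rw [abs_mul]
        have hmi : |∑' p : Pt × Pt, c p * ((p.1 - p.2) i : ℝ)| ≤ C * Θ1 := by
          have h := norm_tsum_le_tsum_norm (summable_firstMoment hδ hc i).norm
          simp only [Real.norm_eq_abs] at h
          refine h.trans ((Summable.tsum_le_tsum (fun p => ?_) (summable_firstMoment hδ hc i).abs (summable_loc_mul_pow hδ hc 1)).trans h1b)
          rw [abs_mul, pow_one]
          exact mul_le_mul_of_nonneg_left ((abs_coord_le_l1 (p.1 - p.2) i).trans (l1_sub_le_letters p.1 p.2)) (abs_nonneg _)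
        exact mul_le_mul hmi (hF1z i) (abs_nonneg _) (by positivity)
      calc ∑ i, |(∑' p : Pt × Pt, c p * ((p.1 - p.2) i : ℝ)) * Δ_[(Pi.single i 1 : Pt)] F z| ≤ ∑ _i : Fin 4, C * Θ1 * A₁ := Finset.sum_le_sum hi
        _ = 4 * (C * Θ1 * A₁) := by rw [Finset.sum_const, Finset.card_univ, Fintype.card_fin, nsmul_eq_mul]; norm_num
    have etot : |∑' p : Pt × Pt, c p * F (z + p.1 - p.2) - (∑' p : Pt × Pt, c p) * F z
        - ∑ i, (∑' p : Pt × Pt, c p * ((p.1 - p.2) i : ℝ)) * Δ_[(Pi.single i 1 : Pt)] F z| ≤ C * Kcore := by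
      refine (abs_sub _ _).trans ((add_le_add ((abs_sub _ _).trans (add_le_add e1 e2)) e3).trans (le_of_eq ?_))
      rw [hKcore]; ring
    refine etot.trans ?_
    rw [le_div_iff₀ (by positivity)]
    have key : (n + 1) ^ (a + 2) ≤ (4 : ℝ) ^ (a + 2) := pow_le_pow_left₀ (by positivity) (by linarith) _
    have : 0 ≤ (5 / 4 : ℝ) ^ (a + 2) * Kout := by positivity
    calc C * Kcore * (n + 1) ^ (a + 2) ≤ C * Kcore * (4 : ℝ) ^ (a + 2) := mul_le_mul_of_nonneg_left key (by positivity)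
      _ = C * ((4 : ℝ) ^ (a + 2) * Kcore) := by ring
      _ ≤ C * ((5 / 4 : ℝ) ^ (a + 2) * Kout + (4 : ℝ) ^ (a + 2) * Kcore) :=
          mul_le_mul_of_nonneg_left (le_add_of_nonneg_left this) hC

/-- **H2-a, ORDER ZERO, AT A POINT**: `|c(x,y)| ≤ C·e^{−δ(|x|₁+|y|₁)}`, `|F t| ≤ A₀/(‖t‖∞+1)^a`, `|Δ_iF t| ≤ A₁/(‖t‖∞+1)^{a+1}` ⟹ for EVERY `z ∈ ℤ⁴`,
`|Σ'_{x,y} c(x,y)·F(z+x−y) − (Σ' c)·F z| ≤ K₀/(‖z‖∞+1)^{a+1}`,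
`K₀ := C·((5/4)^{a+1}·(4·A₁·Θ₁/(3/4)^{a+1} + 2A₀·Θ_{a+1}·16^{a+1}) + 4^{a+1}·2A₀·Θ₀)`. [folklore] -/
theorem abs_smear_sub_order0_le_point (hδ : 0 < δ)
    (hc : ∀ p : Pt × Pt, |c p| ≤ C * (Real.exp (-δ * l1 p.1) * Real.exp (-δ * l1 p.2)))
    (hF0 : ∀ t : Pt, |F t| ≤ A₀ / ((supNorm t : ℝ) + 1) ^ a)
    (hF1 : ∀ (t : Pt) (i : Fin 4), |Δ_[(Pi.single i 1 : Pt)] F t| ≤ A₁ / ((supNorm t : ℝ) + 1) ^ (a + 1)) (z : Pt) :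
    |∑' p : Pt × Pt, c p * F (z + p.1 - p.2) - (∑' p : Pt × Pt, c p) * F z|
      ≤ C * ((5 / 4 : ℝ) ^ (a + 1)
              * (4 * A₁ * (2 ^ (1 + 1) * (((1 : ℕ).factorial : ℝ) * Real.exp (δ / 2) * (2 / δ) ^ 1) * Real.exp (δ / 2) * Zl 4 (δ / 2) ^ 2) / (3 / 4 : ℝ) ^ (a + 1)
                + 2 * A₀ * (2 ^ (a + 1 + 1) * (((a + 1).factorial : ℝ) * Real.exp (δ / 2) * (2 / δ) ^ (a + 1)) * Real.exp (δ / 2) * Zl 4 (δ / 2) ^ 2) * 16 ^ (a + 1))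
            + (4 : ℝ) ^ (a + 1) * (2 * A₀ * (2 ^ (0 + 1) * (((0 : ℕ).factorial : ℝ) * Real.exp (δ / 2) * (2 / δ) ^ 0) * Real.exp (δ / 2) * Zl 4 (δ / 2) ^ 2)))
          / ((supNorm z : ℝ) + 1) ^ (a + 1) := by
  have hC := nonneg_of_loc hc
  have hA0 := nonneg_of_decay_pow hF0
  have hA1 : 0 ≤ A₁ := nonneg_of_decay_pow (fun t => hF1 t 0)
  set Θ0 : ℝ := 2 ^ (0 + 1) * (((0 : ℕ).factorial : ℝ) * Real.exp (δ / 2) * (2 / δ) ^ 0) * Real.exp (δ / 2) * Zl 4 (δ / 2) ^ 2 with hΘ0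
  set Θ1 : ℝ := 2 ^ (1 + 1) * (((1 : ℕ).factorial : ℝ) * Real.exp (δ / 2) * (2 / δ) ^ 1) * Real.exp (δ / 2) * Zl 4 (δ / 2) ^ 2 with hΘ1
  set Θk : ℝ := 2 ^ (a + 1 + 1) * (((a + 1).factorial : ℝ) * Real.exp (δ / 2) * (2 / δ) ^ (a + 1)) * Real.exp (δ / 2) * Zl 4 (δ / 2) ^ 2 with hΘk
  have hZ : 0 < Zl 4 (δ / 2) := Zl_pos (half_pos hδ)
  have hΘ0p : 0 ≤ Θ0 := by positivity
  have hΘ1p : 0 ≤ Θ1 := by positivity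
  have hΘkp : 0 ≤ Θk := by positivity
  set Kout : ℝ := 4 * A₁ * Θ1 / (3 / 4 : ℝ) ^ (a + 1) + 2 * A₀ * Θk * 16 ^ (a + 1) with hKout
  set Kcore : ℝ := 2 * A₀ * Θ0 with hKcore
  have hKout0 : 0 ≤ Kout := by positivity
  have hKcore0 : 0 ≤ Kcore := by positivity
  set n : ℝ := (supNorm z : ℝ) with hn
  have hn0 : 0 ≤ n := by positivity
  have hFA : ∀ t, |F t| ≤ A₀ := fun t => (hF0 t).trans (div_le_self hA0 (one_le_pow₀ (by
    have := (Nat.cast_nonneg (supNorm t) : (0:ℝ) ≤ _); linarith)))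
  show _ ≤ C * ((5 / 4 : ℝ) ^ (a + 1) * Kout + (4 : ℝ) ^ (a + 1) * Kcore) / (n + 1) ^ (a + 1)
  by_cases hz : 4 ≤ supNorm z
  · obtain ⟨hρ1, hρ4, hρ16⟩ := quarter_bounds hz
    set ρ : ℕ := supNorm z / 4 with hρ
    have hn4 : (4 : ℝ) ≤ n := by rw [hn]; exact_mod_cast hz
    have hρpos : (0 : ℝ) < ρ := by exact_mod_cast hρ1
    have h16 : n ≤ 16 * (ρ : ℝ) := by rw [hn]; exact_mod_cast hρ16
    set B : ℝ := A₁ / ((3 / 4 : ℝ) * n) ^ (a + 1) with hB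
    have hB0 : 0 ≤ B := by positivity
    have hF1box : ∀ t : Pt, (∀ i, |t i - z i| ≤ (ρ : ℤ)) → ∀ i, |F (t + Pi.single i 1) - F t| ≤ B := by
      intro t ht i
      have hgeo := box_geometry_one hz ht
      have h := hF1 t i
      have key : ((3 / 4 : ℝ) * n) ^ (a + 1) ≤ ((supNorm t : ℝ) + 1) ^ (a + 1) := pow_le_pow_left₀ (by positivity) hgeo _
      exact h.trans (div_le_div_of_nonneg_left hA1 (by positivity) key)
    have hmain := abs_smear_sub_order0_le (D := 4) hδ hc hFA hρ1 hB0 (a + 1) hF1box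
    refine hmain.trans ?_
    have hρinv : 1 / (ρ : ℝ) ^ (a + 1) ≤ (16 : ℝ) ^ (a + 1) / n ^ (a + 1) := by
      rw [div_le_div_iff₀ (by positivity) (by positivity), one_mul, ← mul_pow]
      exact pow_le_pow_left₀ hn0 h16 _
    have hn_ne : n ≠ 0 := by linarith
    have h34 : ((3 : ℝ) / 4) ^ (a + 1) ≠ 0 := by positivity
    have step1 : C * (((4 : ℕ) : ℝ) * B * Θ1 + 2 * A₀ / (ρ : ℝ) ^ (a + 1) * Θk) ≤ C * (Kout / n ^ (a + 1)) := by
      refine mul_le_mul_of_nonneg_left ?_ hC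
      have t1 : ((4 : ℕ) : ℝ) * B * Θ1 = (4 * A₁ * Θ1 / (3 / 4 : ℝ) ^ (a + 1)) / n ^ (a + 1) := by
        rw [hB, mul_pow]; push_cast; field_simp
      have t2 : 2 * A₀ / (ρ : ℝ) ^ (a + 1) * Θk ≤ 2 * A₀ * Θk * 16 ^ (a + 1) / n ^ (a + 1) := by
        have hnum : 0 ≤ 2 * A₀ * Θk := by positivity
        calc 2 * A₀ / (ρ : ℝ) ^ (a + 1) * Θk = (2 * A₀ * Θk) * (1 / (ρ : ℝ) ^ (a + 1)) := by ring
          _ ≤ (2 * A₀ * Θk) * ((16 : ℝ) ^ (a + 1) / n ^ (a + 1)) := mul_le_mul_of_nonneg_left hρinv hnum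
          _ = _ := by ring
      have eK : Kout / n ^ (a + 1) = (4 * A₁ * Θ1 / (3 / 4 : ℝ) ^ (a + 1)) / n ^ (a + 1) + 2 * A₀ * Θk * 16 ^ (a + 1) / n ^ (a + 1) := by
        rw [hKout, add_div]
      rw [t1, eK]
      linarith
    refine step1.trans ?_
    have h54 : Kout / n ^ (a + 1) ≤ (5 / 4 : ℝ) ^ (a + 1) * Kout / (n + 1) ^ (a + 1) := by
      rw [div_le_div_iff₀ (by positivity) (by positivity)]
      have key : (n + 1) ^ (a + 1) ≤ ((5 / 4 : ℝ) * n) ^ (a + 1) := pow_le_pow_left₀ (by positivity) (by linarith) _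
      calc Kout * (n + 1) ^ (a + 1) ≤ Kout * ((5 / 4 : ℝ) * n) ^ (a + 1) := mul_le_mul_of_nonneg_left key hKout0
        _ = (5 / 4 : ℝ) ^ (a + 1) * Kout * n ^ (a + 1) := by rw [mul_pow]; ring
    have h55 : (5 / 4 : ℝ) ^ (a + 1) * Kout / (n + 1) ^ (a + 1) ≤ ((5 / 4 : ℝ) ^ (a + 1) * Kout + (4 : ℝ) ^ (a + 1) * Kcore) / (n + 1) ^ (a + 1) :=
      div_le_div_of_nonneg_right (le_add_of_nonneg_right (by positivity)) (by positivity)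
    calc C * (Kout / n ^ (a + 1)) ≤ C * ((5 / 4 : ℝ) ^ (a + 1) * Kout / (n + 1) ^ (a + 1)) := mul_le_mul_of_nonneg_left h54 hC
      _ ≤ C * (((5 / 4 : ℝ) ^ (a + 1) * Kout + (4 : ℝ) ^ (a + 1) * Kcore) / (n + 1) ^ (a + 1)) := mul_le_mul_of_nonneg_left h55 hC
      _ = _ := by ring
  · have hz3 : supNorm z ≤ 3 := by omega
    have hn3 : n ≤ 3 := by simp only [hn]; exact_mod_cast hz3
    have hw := summable_weight hδ hc
    have h0 := summable_loc_mul_pow hδ hc 0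
    simp only [pow_zero, mul_one] at h0
    have h0b : ∑' p : Pt × Pt, |c p| ≤ C * Θ0 := by
      have h := tsum_loc_mul_pow_le hδ hc 0
      rw [hΘ0]
      calc ∑' p : Pt × Pt, |c p| = ∑' p : Pt × Pt, |c p| * ((l1 p.1 + 1) + (l1 p.2 + 1)) ^ 0 := by simp
        _ ≤ _ := h
    have e1 : |∑' p : Pt × Pt, c p * F (z + p.1 - p.2)| ≤ C * Θ0 * A₀ := by
      have h := tsum_of_norm_bounded (h0.mul_right A₀).hasSum (f := fun p : Pt × Pt => c p * F (z + p.1 - p.2)) (fun p => by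
        rw [Real.norm_eq_abs, abs_mul]; exact mul_le_mul_of_nonneg_left (hFA _) (abs_nonneg _))
      rw [Real.norm_eq_abs, tsum_mul_right] at h
      exact h.trans (mul_le_mul_of_nonneg_right h0b hA0)
    have e2 : |(∑' p : Pt × Pt, c p) * F z| ≤ C * Θ0 * A₀ := by
      rw [abs_mul]
      have h := norm_tsum_le_tsum_norm hw.norm
      simp only [Real.norm_eq_abs] at h
      exact mul_le_mul (h.trans h0b) (hFA z) (abs_nonneg _) (by positivity)
    have etot : |∑' p : Pt × Pt, c p * F (z + p.1 - p.2) - (∑' p : Pt × Pt, c p) * F z| ≤ C * Kcore := by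
      refine (abs_sub _ _).trans ((add_le_add e1 e2).trans (le_of_eq ?_))
      rw [hKcore]; ring
    refine etot.trans ?_
    rw [le_div_iff₀ (by positivity)]
    have key : (n + 1) ^ (a + 1) ≤ (4 : ℝ) ^ (a + 1) := pow_le_pow_left₀ (by positivity) (by linarith) _
    have : 0 ≤ (5 / 4 : ℝ) ^ (a + 1) * Kout := by positivity
    calc C * Kcore * (n + 1) ^ (a + 1) ≤ C * Kcore * (4 : ℝ) ^ (a + 1) := mul_le_mul_of_nonneg_left key (by positivity)
      _ = C * ((4 : ℝ) ^ (a + 1) * Kcore) := by ring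
      _ ≤ C * ((5 / 4 : ℝ) ^ (a + 1) * Kout + (4 : ℝ) ^ (a + 1) * Kcore) :=
          mul_le_mul_of_nonneg_left (le_add_of_nonneg_left this) hC

end Point

end Summit.QuantumFields.BalabanUV.Beta.FP.ExpLocalisedBubblePoint

end
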